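import Mathlib
import Summits.NavierStokesRegularity.NavierStokesRegularity.Theorems.LerayQuarterDissipationFiniteDissipationLiouvilleAveragedVelocity
import HarnessLib

/-!
# Crux `FiniteDissipationLiouville` (stmt-NavierStokesRegularity-22144): PERIOD-AVERAGED thresholds
# — for PERIODIC majorants (the situation of a discretely self-similar profile, period `T = 2 log λ`
# in similarity time) the backward parabolic averages are bounded by the PERIOD MEAN, so the four
# explicit rungs hold under period-mean conditions

Theorems file of route `LerayQuarterDissipation` (lead prover g16; `--supports` the crux; sequel of
`…AveragedRungs` / `…AveragedVelocity`). Navier–Stokes regularity is NOT proved by anything here; no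
summit is.

For a `λ`-DSS member of the stratum every similarity-variable quantity is `T`-periodic in `s` with
`T = 2 log λ` (`Literature.Analysis.FluidPDE.IsTypeIDSSProfile.lerayOrbit_add_period`); the
catalogued wall `TypeIDSSLiouville` (Bradshaw–Tsai OP 5.1) asks for the triviality of such members.
The averaged rungs accept any continuous majorant; for a PERIODIC one the weighted backward integral
is controlled by one period:

* `integral_exp_weight_mul_periodic_le` — for `b ≥ 0` continuous and `T`-periodic, `κ > 0`, `a ≤ s`:
  `∫_a^s e^{−κ(s−σ)} b(σ) dσ ≤ (∫_0^T b)/(1 − e^{−κT})` (geometric series over past periods);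
* **`eq_zero_of_velocity_periodMean_lt`** — a member of `𝒟_{C,K}` with a continuous `T`-periodic
  majorant `‖U(σ,·)‖_∞ ≤ γ(σ)` and `∫_0^T γ² < 2(1 − e^{−T/2})` vanishes identically — for
  `T = 2 log λ`: **period mean square of the Type-I amplitude `< (1 − λ⁻¹)/log λ`** (`→ 1` as
  `λ → 1⁺`; `≈ 0.72` at `λ = 2`); THRESHOLD ONE with the sup replaced by the period mean;
* `eq_zero_of_vorticityAmplitude_periodMean_lt`, `eq_zero_of_vorticityLThree_periodMean_lt`,
  `eq_zero_of_velocityLSix_periodMean_lt` — the same for the vorticity-amplitude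
  (`∫_0^T γ < (√3/2)(1 − e^{−T/2})`), `L³`-vorticity (`KS²∫_0^T β² < 6(1 − e^{−T/2})`) and
  `L⁶`-velocity (`27KS²∫_0^T w⁴ < 128(1 − e^{−T/2})`) rungs.

HONEST FRAMING. Necessary conditions on a HYPOTHETICAL periodic (e.g. DSS) profile of the stratum;
the law-free DSS class carries the dissipation law by `…Hardness`, so these are sub-cases of
Bradshaw–Tsai OP 5.1 defined by PERIOD-MEAN rather than supremum smallness — nothing is removed from
the wall for large amplitudes; nothing here bears on Navier–Stokes regularity or blow-up.

References: Bradshaw–Tsai, Comm. PDE 42 (2017) OP 5.1; Koch–Nadirashvili–Seregin–Šverák 2009 §5;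
folklore (Grönwall with periodic forcing).
-/

noncomputable section

set_option linter.dupNamespace false

namespace Summit.NavierStokesRegularity.NavierStokesRegularity.Theorems.FiniteDissipationLiouville.Averaged

open MeasureTheory Set Filter Topology Metric InnerProductSpace Function Real
open scoped RealInnerProductSpace ContDiff ENNReal
open Literature.Analysis Literature.Analysis.FluidPDE
open Summit.NavierStokesRegularity.NavierStokesRegularity.Theorems
open Summit.NavierStokesRegularity.NavierStokesRegularity.Theorems.FiniteDissipationLiouville.VorticityLThree

variable {C : ℝ} {V : ℝ → (EuclideanSpace ℝ (Fin 3)) → (EuclideanSpace ℝ (Fin 3))}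

/-! ### The weighted backward integral of a periodic function -/

section Periodic

/-- **Geometric bound for periodic forcing.** For `b ≥ 0` continuous and `T`-periodic (`T > 0`),
`κ > 0` and `a ≤ s`: `∫_a^s e^{−κ(s−σ)} b(σ) dσ ≤ (∫_0^T b)/(1 − e^{−κT})` — on the `k`-th past
period `[s−(k+1)T, s−kT]` the weight is `≤ e^{−κkT}` and `∫ b` equals one period integral.
[folklore] -/
theorem integral_exp_weight_mul_periodic_le {b : ℝ → ℝ} (hbc : Continuous b) (hb0 : ∀ σ, 0 ≤ b σ)
    {T : ℝ} (hT : 0 < T) (hper : Function.Periodic b T) {κ : ℝ} (hκ : 0 < κ) {a s : ℝ}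
    (has : a ≤ s) :
    ∫ σ in a..s, Real.exp (-(κ * (s - σ))) * b σ ≤
      (∫ σ in (0 : ℝ)..T, b σ) / (1 - Real.exp (-(κ * T))) := by
  set I : ℝ := ∫ σ in (0 : ℝ)..T, b σ with hIdef
  set q : ℝ := Real.exp (-(κ * T)) with hqdef
  have hq0 : 0 < q := Real.exp_pos _
  have hq1 : q < 1 := by
    rw [hqdef]; exact Real.exp_lt_one_iff.2 (by nlinarith)
  have hI0 : 0 ≤ I := intervalIntegral.integral_nonneg hT.le fun σ _ => hb0 σ
  have hwc : Continuous fun σ => Real.exp (-(κ * (s - σ))) :=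
    Real.continuous_exp.comp ((continuous_const.mul (continuous_const.sub continuous_id)).neg)
  have hint : ∀ x y : ℝ, IntervalIntegrable (fun σ => Real.exp (-(κ * (s - σ))) * b σ) volume x y :=
    fun x y => (hwc.mul hbc).intervalIntegrable _ _
  have hbint : ∀ x y : ℝ, IntervalIntegrable b volume x y := fun x y => hbc.intervalIntegrable _ _
  -- one period integral from any starting point
  have hperI : ∀ c : ℝ, ∫ σ in (c - T)..c, b σ = I := by
    intro c
    have h := hper.intervalIntegral_add_eq (c - T) 0
    rw [sub_add_cancel, zero_add] at h
    exact h
  -- induction over the number of past periods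
  have key : ∀ n : ℕ, ∀ a : ℝ, s - n * T ≤ a → a ≤ s →
      ∫ σ in a..s, Real.exp (-(κ * (s - σ))) * b σ ≤ I * ∑ k ∈ Finset.range n, q ^ k := by
    intro n
    induction n with
    | zero =>
        intro a h1 h2
        have hsa : a = s := le_antisymm h2 (by simpa using h1)
        rw [hsa, intervalIntegral.integral_same]
        simp
    | succ n ih =>
        intro a h1 h2
        by_cases hcase : s - n * T ≤ a
        · refine (ih a hcase h2).trans ?_
          rw [Finset.sum_range_succ]
          have : 0 ≤ I * q ^ n := mul_nonneg hI0 (pow_nonneg hq0.le n)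
          linarith
        · push Not at hcase
          set c : ℝ := s - n * T with hcdef
          have hcs : c ≤ s := by
            rw [hcdef]; nlinarith [Nat.cast_nonneg (α := ℝ) n]
          have hac : a ≤ c := hcase.le
          rw [← intervalIntegral.integral_add_adjacent_intervals (hint a c) (hint c s)]
          -- the old periods
          have hold := ih c le_rfl hcs
          -- the new period: weight `≤ q^n`, mass `≤ I`
          have hw : ∀ σ ∈ Icc a c, Real.exp (-(κ * (s - σ))) * b σ ≤ q ^ n * b σ := by
            intro σ hσ
            refine mul_le_mul_of_nonneg_right ?_ (hb0 σ)
            rw [hqdef, ← Real.exp_nat_mul]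
            refine Real.exp_le_exp.2 ?_
            have : σ ≤ s - n * T := hσ.2
            nlinarith
          have hnew : ∫ σ in a..c, Real.exp (-(κ * (s - σ))) * b σ ≤ q ^ n * I := by
            calc ∫ σ in a..c, Real.exp (-(κ * (s - σ))) * b σ ≤ ∫ σ in a..c, q ^ n * b σ :=
                  intervalIntegral.integral_mono_on hac (hint a c) ((hbint a c).const_mul _) hw
              _ = q ^ n * ∫ σ in a..c, b σ := intervalIntegral.integral_const_mul _ _
              _ ≤ q ^ n * I := by
                  refine mul_le_mul_of_nonneg_left ?_ (pow_nonneg hq0.le n)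
                  rw [← hperI c]
                  have hcT : c - T ≤ a := by
                    rw [hcdef]; push_cast at h1 ⊢; nlinarith
                  exact intervalIntegral.integral_mono_interval hcT hac le_rfl
                    (Eventually.of_forall fun σ => hb0 σ) (hbint _ _)
          rw [Finset.sum_range_succ, mul_add]
          linarith [hold, hnew, mul_comm I (q ^ n)]
  -- geometric series
  have hgeom : ∀ n : ℕ, I * ∑ k ∈ Finset.range n, q ^ k ≤ I / (1 - q) := by
    intro n
    have hs : ∑ k ∈ Finset.range n, q ^ k = (q ^ n - 1) / (q - 1) := geom_sum_eq hq1.ne n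
    rw [hs, div_eq_mul_inv I]
    refine mul_le_mul_of_nonneg_left ?_ hI0
    have h1q : 0 < 1 - q := by linarith
    rw [show (q ^ n - 1) / (q - 1) = (1 - q ^ n) / (1 - q) by
      rw [← neg_sub 1 (q ^ n), ← neg_sub 1 q, neg_div_neg_eq], inv_eq_one_div]
    exact div_le_div_of_nonneg_right (by linarith [pow_nonneg hq0.le n]) h1q.le
  -- choose `n` with `s - nT ≤ a`
  obtain ⟨n, hn⟩ := exists_nat_ge ((s - a) / T)
  have hn' : s - n * T ≤ a := by
    have := (div_le_iff₀ hT).1 hn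
    linarith
  exact (key n a hn' has).trans (hgeom n)

end Periodic

/-! ### Period-mean forms of the four rungs -/

section Rungs

/-- **THRESHOLD ONE WITH THE PERIOD MEAN.** A member of `𝒟_{C,K}` (any `C`, `K`) whose similarity
velocity has a continuous `T`-periodic majorant `‖U(σ,y)‖ ≤ γ(σ)` (`T > 0`, `γ ≥ 0`) with
`∫_0^T γ² < 2(1 − e^{−T/2})` vanishes identically on `t < 0`. For a `λ`-DSS member (`T = 2 log λ`,
`e^{−T/2} = λ⁻¹`) the condition is: period mean square of `√(−t)‖u‖_∞` below `(1 − λ⁻¹)/log λ`.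
[folklore energy method] -/
theorem eq_zero_of_velocity_periodMean_lt (hV : IsTypeIAncientMild C V) {K : ℝ}
    (hK : ∀ t : ℝ, t < 0 → ∫⁻ x, ‖fderiv ℝ (V t) x‖ₑ ^ 2 ≤ ENNReal.ofReal (K / Real.sqrt (-t)))
    {γ : ℝ → ℝ} (hγc : Continuous γ) (hγ0 : ∀ σ, 0 ≤ γ σ) {T : ℝ} (hT : 0 < T)
    (hper : Function.Periodic γ T) (hU : ∀ σ y, ‖lerayOrbit V σ y‖ ≤ γ σ)
    (hmean : ∫ σ in (0 : ℝ)..T, γ σ ^ 2 < 2 * (1 - Real.exp (-(T / 2)))) :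
    ∀ t < 0, ∀ x, V t x = 0 := by
  have hq1 : Real.exp (-(T / 2)) < 1 := Real.exp_lt_one_iff.2 (by linarith)
  have h1q : 0 < 1 - Real.exp (-(T / 2)) := by linarith
  set Γ₂ : ℝ := (∫ σ in (0 : ℝ)..T, γ σ ^ 2) / (1 - Real.exp (-((1 / 2) * T))) with hΓdef
  have hΓ : ∀ a s : ℝ, a ≤ s → ∫ σ in a..s, Real.exp (-((1 / 2) * (s - σ))) * γ σ ^ 2 ≤ Γ₂ :=
    fun a s has => integral_exp_weight_mul_periodic_le (b := fun σ => γ σ ^ 2) (hγc.pow 2)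
      (fun σ => sq_nonneg _) hT (fun x => by show γ (x + T) ^ 2 = γ x ^ 2; rw [hper x])
      (by norm_num) has
  have hΓlt : Γ₂ < 2 := by
    rw [hΓdef, show (1 / 2 : ℝ) * T = T / 2 by ring, div_lt_iff₀ h1q]
    linarith
  exact eq_zero_of_velocity_avg_lt hV hK hγc hγ0 hU hΓ hΓlt

/-- **Vorticity amplitude with the period mean.** Continuous `T`-periodic majorant
`‖Ω(σ,·)‖_∞ ≤ γ(σ)` with `∫_0^T γ < (√3/2)(1 − e^{−T/2})` forces `V ≡ 0` (period MEAN of `(−t)‖ω‖_∞`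
below `(√3/4)(1 − λ⁻¹)/log λ` for `λ`-DSS members). [folklore energy method] -/
theorem eq_zero_of_vorticityAmplitude_periodMean_lt (hV : IsTypeIAncientMild C V) {K : ℝ}
    (hK : ∀ t : ℝ, t < 0 → ∫⁻ x, ‖fderiv ℝ (V t) x‖ₑ ^ 2 ≤ ENNReal.ofReal (K / Real.sqrt (-t)))
    {γ : ℝ → ℝ} (hγc : Continuous γ) (hγ0 : ∀ σ, 0 ≤ γ σ) {T : ℝ} (hT : 0 < T)
    (hper : Function.Periodic γ T) (hΩ : ∀ σ y, ‖lerayVorticity V σ y‖ ≤ γ σ)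
    (hmean : ∫ σ in (0 : ℝ)..T, γ σ < Real.sqrt 3 / 2 * (1 - Real.exp (-(T / 2)))) :
    ∀ t < 0, ∀ x, V t x = 0 := by
  have hq1 : Real.exp (-(T / 2)) < 1 := Real.exp_lt_one_iff.2 (by linarith)
  have h1q : 0 < 1 - Real.exp (-(T / 2)) := by linarith
  set Γ : ℝ := (∫ σ in (0 : ℝ)..T, γ σ) / (1 - Real.exp (-((1 / 2) * T))) with hΓdef
  have hΓ : ∀ a s : ℝ, a ≤ s → ∫ σ in a..s, Real.exp (-((1 / 2) * (s - σ))) * γ σ ≤ Γ :=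
    fun a s has => integral_exp_weight_mul_periodic_le (b := γ) hγc hγ0 hT hper (by norm_num) has
  have hΓlt : Γ < Real.sqrt 3 / 2 := by
    rw [hΓdef, show (1 / 2 : ℝ) * T = T / 2 by ring, div_lt_iff₀ h1q]
    linarith
  exact eq_zero_of_vorticityAmplitude_avg_lt hV hK hγc hγ0 hΩ hΓ hΓlt

/-- **`L³`-vorticity with the period mean.** Continuous `T`-periodic majorant `∫‖Ω(σ)‖³ ≤ β(σ)³`
with `KS²·∫_0^T β² < 6(1 − e^{−T/2})` forces `V ≡ 0`. [folklore energy method] -/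
theorem eq_zero_of_vorticityLThree_periodMean_lt (hV : IsTypeIAncientMild C V) {K : ℝ}
    (hK : ∀ t : ℝ, t < 0 → ∫⁻ x, ‖fderiv ℝ (V t) x‖ₑ ^ 2 ≤ ENNReal.ofReal (K / Real.sqrt (-t)))
    {β : ℝ → ℝ} (hβc : Continuous β) (hβ0 : ∀ σ, 0 ≤ β σ) {T : ℝ} (hT : 0 < T)
    (hper : Function.Periodic β T)
    (hΩ3 : ∀ σ : ℝ, Integrable (fun y => ‖lerayVorticity V σ y‖ ^ 3) ∧
      ∫ y, ‖lerayVorticity V σ y‖ ^ 3 ≤ β σ ^ 3)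
    (hmean : (SNormLESNormFDerivOfEqConst (EuclideanSpace ℝ (Fin 3))
        (volume : Measure (EuclideanSpace ℝ (Fin 3))) 2 : ℝ) ^ 2 * ∫ σ in (0 : ℝ)..T, β σ ^ 2 <
        6 * (1 - Real.exp (-(T / 2)))) :
    ∀ t < 0, ∀ x, V t x = 0 := by
  have hq1 : Real.exp (-(T / 2)) < 1 := Real.exp_lt_one_iff.2 (by linarith)
  have h1q : 0 < 1 - Real.exp (-(T / 2)) := by linarith
  set A : ℝ := (∫ σ in (0 : ℝ)..T, β σ ^ 2) / (1 - Real.exp (-((1 / 2) * T))) with hAdef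
  have hA : ∀ a s : ℝ, a ≤ s → ∫ σ in a..s, Real.exp (-((1 / 2) * (s - σ))) * β σ ^ 2 ≤ A :=
    fun a s has => integral_exp_weight_mul_periodic_le (b := fun σ => β σ ^ 2) (hβc.pow 2)
      (fun σ => sq_nonneg _) hT (fun x => by show β (x + T) ^ 2 = β x ^ 2; rw [hper x])
      (by norm_num) has
  have hq : (SNormLESNormFDerivOfEqConst (EuclideanSpace ℝ (Fin 3))
        (volume : Measure (EuclideanSpace ℝ (Fin 3))) 2 : ℝ) ^ 2 * A < 6 := by
    rw [hAdef, show (1 / 2 : ℝ) * T = T / 2 by ring, ← mul_div_assoc, div_lt_iff₀ h1q]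
    linarith
  exact eq_zero_of_vorticityLThree_avg_lt hV hK hβc hβ0 hΩ3 hA hq

/-- **`L⁶`-velocity with the period mean.** Continuous `T`-periodic majorant `∫‖U(σ)‖⁶ ≤ w(σ)⁶`
with `27KS²·∫_0^T w⁴ < 128(1 − e^{−T/2})` forces `V ≡ 0`. [folklore energy method] -/
theorem eq_zero_of_velocityLSix_periodMean_lt (hV : IsTypeIAncientMild C V) {K : ℝ}
    (hK : ∀ t : ℝ, t < 0 → ∫⁻ x, ‖fderiv ℝ (V t) x‖ₑ ^ 2 ≤ ENNReal.ofReal (K / Real.sqrt (-t)))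
    {w : ℝ → ℝ} (hwc : Continuous w) (hw0 : ∀ σ, 0 ≤ w σ) {T : ℝ} (hT : 0 < T)
    (hper : Function.Periodic w T)
    (hU6 : ∀ σ : ℝ, Integrable (fun y => ‖lerayOrbit V σ y‖ ^ 6) ∧
      ∫ y, ‖lerayOrbit V σ y‖ ^ 6 ≤ w σ ^ 6)
    (hmean : 27 * ((SNormLESNormFDerivOfEqConst (EuclideanSpace ℝ (Fin 3))
        (volume : Measure (EuclideanSpace ℝ (Fin 3))) 2 : ℝ) ^ 2 * ∫ σ in (0 : ℝ)..T, w σ ^ 4) <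
        128 * (1 - Real.exp (-(T / 2)))) :
    ∀ t < 0, ∀ x, V t x = 0 := by
  have hq1 : Real.exp (-(T / 2)) < 1 := Real.exp_lt_one_iff.2 (by linarith)
  have h1q : 0 < 1 - Real.exp (-(T / 2)) := by linarith
  set A : ℝ := (∫ σ in (0 : ℝ)..T, w σ ^ 4) / (1 - Real.exp (-((1 / 2) * T))) with hAdef
  have hA : ∀ a s : ℝ, a ≤ s → ∫ σ in a..s, Real.exp (-((1 / 2) * (s - σ))) * w σ ^ 4 ≤ A :=
    fun a s has => integral_exp_weight_mul_periodic_le (b := fun σ => w σ ^ 4) (hwc.pow 4)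
      (fun σ => by positivity) hT (fun x => by show w (x + T) ^ 4 = w x ^ 4; rw [hper x])
      (by norm_num) has
  have hq : 27 * ((SNormLESNormFDerivOfEqConst (EuclideanSpace ℝ (Fin 3))
        (volume : Measure (EuclideanSpace ℝ (Fin 3))) 2 : ℝ) ^ 2 * A) < 128 := by
    rw [hAdef, show (1 / 2 : ℝ) * T = T / 2 by ring, ← mul_div_assoc, ← mul_div_assoc,
      div_lt_iff₀ h1q]
    linarith
  exact eq_zero_of_velocityLSix_avg_lt hV hK hwc hw0 hU6 hA hq

end Rungs

end Summit.NavierStokesRegularity.NavierStokesRegularity.Theorems.FiniteDissipationLiouville.Averaged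

end
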